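import Mathlib
import HarnessLib
import Literature.Analysis.FluidPDE.NSVorticityBKMHolds
import Literature.Analysis.FluidPDE.TaoLocalisationHolds
import Literature.Analysis.FluidPDE.StretchingRate
import Literature.Analysis.FluidPDE.ClassicalSolutionCalculus
import Summits.NavierStokesRegularity.NavierStokesRegularity.Theorems.AdaptedFrequencyEnstrophyDensity
import Summits.NavierStokesRegularity.NavierStokesRegularity.Theorems.IsobarTomographyBlobRiccatiClosureStubContinuation
import Summits.NavierStokesRegularity.NavierStokesRegularity.Theorems.IsobarTomographyBlobRiccatiClosureStubPressureLaplacian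
import Summits.NavierStokesRegularity.NavierStokesRegularity.Theorems.IsobarTomographyBlobRiccatiClosureStubPeakGrowth
import Summits.NavierStokesRegularity.NavierStokesRegularity.Theorems.IsobarTomographyBlobRiccatiClosureStubUniformDecay
import Summits.NavierStokesRegularity.NavierStokesRegularity.Theorems.IsobarTomographyBlobRiccatiClosureStubSupGronwall
import Summits.NavierStokesRegularity.NavierStokesRegularity.Theorems.IsobarTomographyBlobRiccatiClosureStubStretchingEvolution
import Summits.NavierStokesRegularity.NavierStokesRegularity.Theses.IsobarTomography

/-!
# Skeleton — line `Sketch` for crux `IsobarTomography.BlobRiccatiClosure`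
(stmt-NavierStokesRegularity-11740; lead prover-line-stmt-NavierStokesRegularity-11740-0, continued by lead c1
prover-line-stmt-NavierStokesRegularity-11740-c1-0)

The crux: a finite-energy (Leray–Hopf) classical solution `(u, p)` of unforced Navier–Stokes on
`ℝ³ × [0, T)` from a rapidly decaying datum which satisfies the BLOB HYPOTHESIS — some `κ > 0`,
threshold `Ω(t)` and `t₀ < T` such that for `t ∈ [t₀, T)` the peak set `{‖ω(t,·)‖ > Ω(t)}` is
non-empty and on it `κ ‖ω‖² Δp ≤ D²p[ω, ω]` — extends classically past `T`.

The line (ideator-2 sheet `Sketch`, cards `core-gas-riemann-ledger` / `depolarization-aspect-ledger`,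
foreseen shape "blob ⇒ ∫ sup-over-peaks α₊ dt < ∞ ⇒ BKM") is rebuilt here as a PEAK REDUCTION:
everything except the behaviour of the stretching rate `α = ⟪ξ, (∇u) ξ⟫` AT THE VORTICITY MAXIMUM is
bookkeeping provable from the tree, and is isolated in stubs S1–S5; the open content is the single
bet S6.

* `stub_continuation` (S1, PROVED here): a vorticity bound on `[t₀, T)` continues the solution past
  `T` (Tao 2013 Sobolev bounds on closed slabs `tao2011_hasBoundedSobolevNormsOn_holds` + Sobolev
  imbedding on `[0, max t₀ T/2]` + the discharged Beale–Kato–Majda criterion `beale_kato_majda_holds`).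
* `stub_pressureLaplacian` (S2): the pressure Poisson equation in peak currency,
  `Δp = ‖ω‖² − |∇u|²_F` (`= ½‖ω‖² − |S|²_F`) at interior times.
* `stub_peakGrowth` (S3): at a spatial maximum `x⋆` of `‖ω(t,·)‖²`,
  `∂ₜ‖ω‖²(t,x⋆) ≤ 2‖ω‖² α(t,x⋆)` (enstrophy-density identity `opL_norm_curl_sq_eq` + first/second
  order conditions at the maximum).
* `stub_uniformDecay` (S4a): on every `[0, t₁]`, `t₁ < T`, `∂ₜ‖ω‖²` is bounded and `‖ω(t,x)‖² → 0`
  as `‖x‖ → ∞` UNIFORMLY in `t` (slab derivative bounds + `∂ₜω = νΔω − curl((u·∇)u)` is pressure-free).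
* `stub_supGronwall` (S4b, pure real analysis): Danskin + Grönwall for `m(t) = sup_x f(t,x)` when
  `∂ₜf ≤ g f` at the positive maxima and `f(t,·)` vanishes at infinity locally uniformly in `t`.
* `stub_stretchingEvolution` (S5, the Galanti–Gibbon–Heritage / Ohkitani "stretching Riccati law" in
  conservative form): `(∂ₜ + u·∇ − νΔ)⟪ω, ∇u ω⟫ = ‖∇u ω‖² − D²p[ω,ω] − 2ν(…)` pointwise. Not used by
  the composition (tool for the bet); registered so that it can be landed `--supports`.
* `stub_peakStretchingBound` (S6, THE BET): under the blob hypothesis the stretching rate at every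
  vorticity maximum has a continuous majorant `g` on `[t₀, T)` with `∫_{t₀}^t g ≤ I` uniformly.
  This is the crux's open content (its informal mechanism: the Riccati law S5 with the axial pressure
  curvature signed by the blob inequality; what is NOT signed is the tilting `|ξ × Sξ|²`, the viscous
  terms and the motion of the argmax — ATTACK.md §8, the route's "why it might fail").

Composition `BlobRiccatiClosure_of`: S6 ⇒ `g`; S3 + S6 ⇒ `∂ₜ‖ω‖² ≤ 2g‖ω‖²` at positive maxima;
S4a ⇒ the hypotheses of S4b for `f = ‖ω‖²` on `[t₀, T)`; S4b ⇒ `‖ω(t,x)‖² ≤ (sup ‖ω(t₀,·)‖²) e^{2I}`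
on `[t₀, T)`; S1 ⇒ `HasSmoothExtensionPast`.
-/

noncomputable section

open MeasureTheory Set Function Filter Topology
open scoped ENNReal NNReal InnerProductSpace RealInnerProductSpace Laplacian

-- the summit and its single sub-problem share the name (CONVENTIONS §1), as in every Theorems file
set_option linter.dupNamespace false

namespace Summit.NavierStokesRegularity.NavierStokesRegularity.Theorems.IsobarTomographyBlobRiccatiClosure

open Literature.Analysis Literature.Analysis.FluidPDE
open Summit.NavierStokesRegularity.NavierStokesRegularity.Theorems

local notation "E³" => EuclideanSpace ℝ (Fin 3)

/-! ### Stub S1 — continuation from a vorticity bound on `[t₀, T)` (PROVED, landed p108696) -/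

/-- **S1, CONTINUATION FROM A LATE VORTICITY BOUND.** A classical solution of unforced
Navier–Stokes on `ℝ³ × [0, T)`, Leray–Hopf from its rapidly decaying datum, whose squared vorticity
is bounded by `B` on `[t₀, T) × ℝ³` for some `t₀ < T`, extends classically past `T`.
Proof: Tao 2013 (`tao2011_hasBoundedSobolevNormsOn_holds`) puts the solution in the BKM class on every
closed slab `[0, T₁]`, `T₁ < T`; Sobolev imbedding bounds the vorticity on `[0, max t₀ (T/2)]`
(`exists_enorm_curl_le_of_hasBoundedSobolevNormsOn`); so `∫₀ᵀ ‖curl u‖_∞ < ∞` and the discharged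
Beale–Kato–Majda criterion `beale_kato_majda_holds` continues the solution in the class.
(Adapted from `coreLogGas_coreReductionContinuation_proof`.) -/
theorem stub_continuation :
    ∀ (ν T t₀ B : ℝ) (u : ℝ → E³ → E³) (p : ℝ → E³ → ℝ), 0 < ν → 0 < T → t₀ < T →
      IsClassicalNSSolutionOn (Ico 0 T) ν 0 u p → IsLerayHopfOn T ν 0 (u 0) u →
      HasRapidSpatialDecay (u 0) →
      (∀ t ∈ Ico t₀ T, ∀ x : E³, ‖curl (u t) x‖ ^ 2 ≤ B) →
      HasSmoothExtensionPast ν 0 u T :=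
  BlobRiccatiClosure.Sketch.stub_continuation

/-! ### Stub S2 — the pressure Poisson equation in peak currency -/

/-- **S2, PRESSURE LAPLACIAN.** For a classical solution of unforced Navier–Stokes on `[0, T)` and an
interior time `t ∈ (0, T)`: `Δp(t,x) = ‖curl u(t,x)‖² − |∇u(t,x)|²_F` (equivalently `½‖ω‖² − |S|²_F`,
i.e. `Δp = 2Q`). Take the divergence of the momentum equation
(`laplacian_pressure_eq_of_isClassicalNSSolutionOn`), use `div((u·∇)u) = tr(∇u ∘ ∇u)`
(`divergence_convect_self_eq`) and the algebra `tr(A²) = |A|²_F − ‖curl‖²`. -/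
theorem stub_pressureLaplacian :
    ∀ (ν T : ℝ) (u : ℝ → E³ → E³) (p : ℝ → E³ → ℝ),
      IsClassicalNSSolutionOn (Ico 0 T) ν 0 u p →
      ∀ t ∈ Ioo 0 T, ∀ x : E³,
        Laplacian.laplacian (p t) x = ‖curl (u t) x‖ ^ 2 - frobeniusNormSq (fderiv ℝ (u t) x) :=
  BlobRiccatiClosure.Sketch.stub_pressureLaplacian

/-! ### Stub S3 — growth of the squared vorticity at a spatial maximum -/

/-- **S3, PEAK GROWTH INEQUALITY.** For a classical solution of unforced Navier–Stokes (`ν ≥ 0`) on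
`[0, T)`, at every `t ∈ [0, T)` and every spatial maximum point `x⋆` of `‖curl u(t, ·)‖²`:
`∂ₜ‖ω‖²(t, x⋆) ≤ 2 ‖ω(t,x⋆)‖² α(t,x⋆)`, `α = stretchingRate` (one-sided time derivative within
`[0, T)`). From the enstrophy-density identity `opL_norm_curl_sq_eq`
(`∂ₜ‖ω‖² + D‖ω‖²·u − νΔ‖ω‖² = 2⟪ω, ∇u ω⟫ − 2ν|∇ω|²_F`) with `D‖ω‖²(x⋆) = 0`, `Δ‖ω‖²(x⋆) ≤ 0`
(`IsLocalMax.laplacian_nonpos`) and `⟪ω, ∇u ω⟫ = ‖ω‖² α` (`norm_curl_sq_mul_stretchingRate`). -/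
theorem stub_peakGrowth :
    ∀ (ν T : ℝ) (u : ℝ → E³ → E³) (p : ℝ → E³ → ℝ), 0 ≤ ν → 0 < T →
      IsClassicalNSSolutionOn (Ico 0 T) ν 0 u p →
      ∀ t ∈ Ico 0 T, ∀ x : E³, IsMaxOn (fun y => ‖curl (u t) y‖ ^ 2) univ x →
        timeDerivWithin (Ico 0 T) (fun s y => ‖curl (u s) y‖ ^ 2) t x ≤
          2 * (‖curl (u t) x‖ ^ 2 * stretchingRate (u t) x) :=
  BlobRiccatiClosure.Sketch.stub_peakGrowth

/-! ### Stub S4a — uniform-in-time spatial decay of the vorticity and a bound on `∂ₜ‖ω‖²` -/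

/-- **S4a, UNIFORM DECAY ON COMPACT TIME INTERVALS.** For a classical solution of unforced
Navier–Stokes on `[0, T)`, Leray–Hopf from its rapidly decaying datum, and every `t₁ < T`:
(i) `|∂ₜ‖curl u‖²| ≤ B` on `[0, t₁] × ℝ³`; (ii) for every `ε > 0` there is `R` with
`‖curl u(t,x)‖² ≤ ε` whenever `t ∈ [0, t₁]`, `‖x‖ ≥ R`. Route: on the closed slab `[0, max t₁ (T/2)]`
all derivatives of `u` are bounded (`tao2011_hasBoundedSobolevNormsOn_holds`,
`exists_forall_norm_iteratedFDeriv_le_of_hasBoundedSobolevNormsOn`), whence (i) and a bound on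
`∂ₜ curl u = νΔ curl u − curl((u·∇)u)` (pressure-free) by `exists_enstrophyDensity_bounds`; each
slice `‖curl u(s,·)‖²` is Lipschitz and integrable (`∫‖∇u(s)‖² < ∞`), hence tends to `0` at
infinity; a finite net in `s` and the time-Lipschitz bound give uniformity. -/
theorem stub_uniformDecay :
    ∀ (ν T : ℝ) (u : ℝ → E³ → E³) (p : ℝ → E³ → ℝ), 0 < ν → 0 < T →
      IsClassicalNSSolutionOn (Ico 0 T) ν 0 u p → IsLerayHopfOn T ν 0 (u 0) u →
      HasRapidSpatialDecay (u 0) →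
      ∀ t₁ < T,
        (∃ B : ℝ, ∀ t ∈ Icc 0 t₁, ∀ x : E³,
            |timeDerivWithin (Ico 0 T) (fun s y => ‖curl (u s) y‖ ^ 2) t x| ≤ B) ∧
        (∀ ε : ℝ, 0 < ε → ∃ R : ℝ, ∀ t ∈ Icc 0 t₁, ∀ x : E³, R ≤ ‖x‖ → ‖curl (u t) x‖ ^ 2 ≤ ε) :=
  BlobRiccatiClosure.Sketch.stub_uniformDecay

/-! ### Stub S4b — Danskin + Grönwall for the spatial supremum (pure real analysis) -/

/-- **S4b, SUP-GRÖNWALL.** Let `f, f' : ℝ → ℝ³ → ℝ` be jointly continuous on `[a, b) × ℝ³`, `f ≥ 0`,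
`f'(t,x)` the time-derivative of `f(·,x)` within `[a, b)` at every `t ∈ [a, b)` (two-sided at
interior times, from the right at `a`), with `|f'|` bounded on
`[a, t₁] × ℝ³` and `f(t, x) → 0` as `‖x‖ → ∞` uniformly in `t ∈ [a, t₁]`, for every `t₁ < b`.
If `g` is continuous on `[a, b)` and `f'(t, x⋆) ≤ g(t) f(t, x⋆)` at every spatial maximum `x⋆`
of `f(t,·)` with `f(t,x⋆) > 0`, then `f(t, x) ≤ (sup f(a,·)) · exp(∫ₐᵗ g)` on `[a, b) × ℝ³`.
(Danskin: the upper right Dini derivative of the locally Lipschitz `m(t) = max f(t,·)` at a time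
with `m(t) > 0` is at most `g(t) m(t)`, maxima being confined to a compact set by the uniform decay;
then Mathlib's `image_le_of_liminf_slope_right_lt_deriv_boundary'` with the barrier
`(m(a)+ε) exp(∫ₐᵗ (g+ε))`, `ε → 0`.) -/
theorem stub_supGronwall :
    ∀ (a b : ℝ) (f f' : ℝ → E³ → ℝ) (g : ℝ → ℝ), a < b →
      ContinuousOn (uncurry f) (Ico a b ×ˢ univ) →
      ContinuousOn (uncurry f') (Ico a b ×ˢ univ) →
      (∀ t ∈ Ico a b, ∀ x : E³, HasDerivWithinAt (fun s => f s x) (f' t x) (Ico a b) t) →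
      (∀ t ∈ Ico a b, ∀ x : E³, 0 ≤ f t x) →
      (∀ t₁ ∈ Ico a b, ∃ B : ℝ, ∀ t ∈ Icc a t₁, ∀ x : E³, |f' t x| ≤ B) →
      (∀ t₁ ∈ Ico a b, ∀ ε : ℝ, 0 < ε → ∃ R : ℝ, ∀ t ∈ Icc a t₁, ∀ x : E³, R ≤ ‖x‖ → f t x ≤ ε) →
      ContinuousOn g (Ico a b) →
      (∀ t ∈ Ico a b, ∀ x : E³, IsMaxOn (f t) univ x → 0 < f t x → f' t x ≤ g t * f t x) →
      ∀ t ∈ Ico a b, ∀ x : E³, f t x ≤ (⨆ y, f a y) * Real.exp (∫ s in a..t, g s) :=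
  BlobRiccatiClosure.Sketch.stub_supGronwall

/-! ### Stub S5 — the stretching Riccati law (Galanti–Gibbon–Heritage / Ohkitani), conservative form -/

/-- **S5, STRETCHING EVOLUTION IDENTITY.** For a classical solution of unforced Navier–Stokes on
`[0, T)`, with `ω = curl u`, `A = ∇u` (`A h = Du·h`, so `(ω·∇)u = A ω`), the vortex-stretching density
`r = ⟪ω, A ω⟫ = ‖ω‖² α` obeys pointwise on `[0, T) × ℝ³`
`(∂ₜ + u·∇ − νΔ) r = ‖A ω‖² − D²p[ω, ω] − 2ν Σᵢ (⟪ω, ∂ᵢA ∂ᵢω⟫ + ⟪∂ᵢω, ∂ᵢA ω⟫ + ⟪∂ᵢω, A ∂ᵢω⟫)`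
(`∂ᵢ` along the standard basis). Ingredients: the vorticity equation `(∂ₜ + u·∇ − νΔ)ω = Aω`
(`IsClassicalNSSolutionOn.isVorticitySolutionOn_of_uniqueDiffOn`), the spatial derivative of the
momentum equation `(∂ₜ + u·∇ − νΔ)A = −A∘A − D∇p` (Ohkitani: `D_t(Sω) = −Pω` for Euler), and the
Leibniz rule for `Δ`. Galanti–Gibbon–Heritage, Nonlinearity 10 (1997) 1675, eq. for `α`;
Majda–Bertozzi §1.4. Registered as a tool for the bet; not used by the composition. -/
theorem stub_stretchingEvolution :
    ∀ (ν T : ℝ) (u : ℝ → E³ → E³) (p : ℝ → E³ → ℝ), 0 < T →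
      IsClassicalNSSolutionOn (Ico 0 T) ν 0 u p →
      ∀ t ∈ Ico 0 T, ∀ x : E³,
        timeDerivWithin (Ico 0 T) (fun s y => ⟪curl (u s) y, fderiv ℝ (u s) y (curl (u s) y)⟫) t x +
            fderiv ℝ (fun y => ⟪curl (u t) y, fderiv ℝ (u t) y (curl (u t) y)⟫) x (u t x) -
            ν * Laplacian.laplacian
              (fun y => ⟪curl (u t) y, fderiv ℝ (u t) y (curl (u t) y)⟫) x =
          ‖fderiv ℝ (u t) x (curl (u t) x)‖ ^ 2 -
            iteratedFDeriv ℝ 2 (p t) x ![curl (u t) x, curl (u t) x] -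
            2 * ν * ∑ i : Fin 3,
              (⟪curl (u t) x, (fderiv ℝ (fderiv ℝ (u t)) x (EuclideanSpace.single i 1))
                  (fderiv ℝ (curl (u t)) x (EuclideanSpace.single i 1))⟫ +
                ⟪fderiv ℝ (curl (u t)) x (EuclideanSpace.single i 1),
                  (fderiv ℝ (fderiv ℝ (u t)) x (EuclideanSpace.single i 1)) (curl (u t) x)⟫ +
                ⟪fderiv ℝ (curl (u t)) x (EuclideanSpace.single i 1),
                  fderiv ℝ (u t) x (fderiv ℝ (curl (u t)) x (EuclideanSpace.single i 1))⟫) :=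
  BlobRiccatiClosure.Sketch.stub_stretchingEvolution

/-! ### Stub S6 — THE BET: an integrable majorant for the stretching rate at the vorticity maximum -/

/-- **S6, PEAK STRETCHING BOUND (THE BET).** Granted the pressure Poisson equation (S2): for a
classical solution of unforced Navier–Stokes on `[0, T)`, Leray–Hopf from its rapidly decaying datum,
satisfying the blob hypothesis with `(κ, Ω, t₀)`, there are `t₁ ∈ [t₀, T)` and a function `g`, continuous
on `[t₁, T)` with `∫_{t₁}^t g ≤ I` for all `t ∈ [t₁, T)`, such that at every `t ∈ [t₁, T)` and every spatial
maximum point `x⋆` of `‖curl u(t,·)‖²` with `curl u(t,x⋆) ≠ 0` (such a point lies in the peak set),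
the stretching rate obeys `α(t, x⋆) ≤ g(t)`. This is the open content of the crux: the informal
mechanism (route text; S5 with `−D²p[ξ,ξ] ≤ −κΔp = −κ(½‖ω‖² − |S|²)` on the peaks) signs the axial
pressure curvature but not the tilting `|ξ × Sξ|²`, the viscous terms, or the motion of the argmax
(refuter ATTACK.md §8: restricted Euler blows up with the blob clause holding identically, `κ = 1/3`). -/
theorem stub_peakStretchingBound
    (hPoisson : ∀ (ν T : ℝ) (u : ℝ → E³ → E³) (p : ℝ → E³ → ℝ),
      IsClassicalNSSolutionOn (Ico 0 T) ν 0 u p →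
      ∀ t ∈ Ioo 0 T, ∀ x : E³,
        Laplacian.laplacian (p t) x = ‖curl (u t) x‖ ^ 2 - frobeniusNormSq (fderiv ℝ (u t) x)) :
    ∀ (ν T : ℝ) (u : ℝ → E³ → E³) (p : ℝ → E³ → ℝ) (κ : ℝ) (Ω : ℝ → ℝ) (t₀ : ℝ),
      0 < ν → 0 < T →
      IsClassicalNSSolutionOn (Ico 0 T) ν 0 u p → IsLerayHopfOn T ν 0 (u 0) u →
      HasRapidSpatialDecay (u 0) → 0 < κ → t₀ ∈ Ico 0 T →
      (∀ t ∈ Ico t₀ T, (∃ x : E³, Ω t < ‖curl (u t) x‖) ∧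
        ∀ x : E³, Ω t < ‖curl (u t) x‖ →
          κ * ‖curl (u t) x‖ ^ 2 * Laplacian.laplacian (p t) x ≤
            iteratedFDeriv ℝ 2 (p t) x ![curl (u t) x, curl (u t) x]) →
      ∃ t₁ ∈ Ico t₀ T, ∃ g : ℝ → ℝ, ContinuousOn g (Ico t₁ T) ∧
        (∃ I : ℝ, ∀ t ∈ Ico t₁ T, ∫ s in t₁..t, g s ≤ I) ∧
        ∀ t ∈ Ico t₁ T, ∀ x : E³, IsMaxOn (fun y => ‖curl (u t) y‖ ^ 2) univ x →
          curl (u t) x ≠ 0 → stretchingRate (u t) x ≤ g t := by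
  sorry

/-! ### The peak-stretching continuation criterion (S1 + S3 + S4a + S4b assembled; PROVED) -/

/-- **PEAK-STRETCHING CONTINUATION CRITERION** (the line's reduction in closed form). Let `(u, p)` be a
classical solution of unforced Navier–Stokes on `ℝ³ × [0, T)`, Leray–Hopf from its rapidly decaying datum, and
suppose that on some `[t₁, T)`, `0 ≤ t₁ < T`, the stretching rate at every spatial maximum `x⋆` of
`‖curl u(t,·)‖²` with `curl u(t,x⋆) ≠ 0` is bounded by `g(t)`, `g` continuous on `[t₁, T)` with
`∫_{t₁}^t g ≤ I` for all `t`. Then the solution extends classically past `T`. (Peak-localised form of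
"d⁺/dt ‖ω‖_∞ ≤ α(x⋆)‖ω‖_∞ + Beale–Kato–Majda", Majda–Bertozzi §5.1 (5.8)–(5.12), Constantin–Fefferman 1993 §1:
S3 gives `∂ₜ‖ω‖² ≤ 2g‖ω‖²` at positive maxima, S4a the hypotheses of the sup-Grönwall lemma S4b for
`f = ‖curl u‖²` on `[t₁, T)`, S4b the bound `‖ω‖² ≤ (sup‖ω(t₁,·)‖²) e^{2I}`, S1 the extension.) -/
theorem peakStretching_continuation :
    ∀ (ν T t₁ : ℝ) (u : ℝ → E³ → E³) (p : ℝ → E³ → ℝ) (g : ℝ → ℝ), 0 < ν → 0 < T → t₁ ∈ Ico 0 T →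
      IsClassicalNSSolutionOn (Ico 0 T) ν 0 u p → IsLerayHopfOn T ν 0 (u 0) u →
      HasRapidSpatialDecay (u 0) →
      ContinuousOn g (Ico t₁ T) → (∃ I : ℝ, ∀ t ∈ Ico t₁ T, ∫ s in t₁..t, g s ≤ I) →
      (∀ t ∈ Ico t₁ T, ∀ x : E³, IsMaxOn (fun y => ‖curl (u t) y‖ ^ 2) univ x →
          curl (u t) x ≠ 0 → stretchingRate (u t) x ≤ g t) →
      HasSmoothExtensionPast ν 0 u T := by
  intro ν T t₁ u p g hν hT ht₁0 hsol hLH hdec hgc hI hgα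
  obtain ⟨I, hI⟩ := hI
  -- the squared vorticity and its one-sided time derivative
  set f : ℝ → E³ → ℝ := fun t x => ‖curl (u t) x‖ ^ 2 with hf
  set f' : ℝ → E³ → ℝ := fun t x => timeDerivWithin (Ico 0 T) (fun s y => ‖curl (u s) y‖ ^ 2) t x
    with hf'
  have hS : UniqueDiffOn ℝ (Ico 0 T) := uniqueDiffOn_Ico 0 T
  have hωs : IsSmoothSpaceTimeOn (Ico 0 T) (vorticity u) :=
    isSmoothSpaceTimeOn_vorticity_of_classical hsol hS
  have hfs : IsSmoothSpaceTimeOn (Ico 0 T) f := by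
    have h1 := ContDiffOn.norm_sq ℝ hωs
    unfold IsSmoothSpaceTimeOn
    refine h1.congr fun z _ => ?_
    obtain ⟨t, x⟩ := z
    simp [hf, vorticity]
  have hf's : IsSmoothSpaceTimeOn (Ico 0 T) f' := by
    have h1 := hfs.timeDerivWithin hS
    unfold IsSmoothSpaceTimeOn at h1 ⊢
    refine h1.congr fun z _ => ?_
    obtain ⟨t, x⟩ := z
    simp [hf', hf]
  have hsub : Ico t₁ T ⊆ Ico 0 T := fun t ht => ⟨ht₁0.1.trans ht.1, ht.2⟩
  have hprod : Ico t₁ T ×ˢ (univ : Set E³) ⊆ Ico 0 T ×ˢ univ := prod_mono hsub Subset.rfl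
  have hcont : ContinuousOn (uncurry f) (Ico t₁ T ×ˢ univ) := hfs.continuousOn.mono hprod
  have hcont' : ContinuousOn (uncurry f') (Ico t₁ T ×ˢ univ) := hf's.continuousOn.mono hprod
  have hderiv : ∀ t ∈ Ico t₁ T, ∀ x : E³,
      HasDerivWithinAt (fun s => f s x) (f' t x) (Ico t₁ T) t := by
    intro t ht x
    have h1 : HasDerivWithinAt (fun s => f s x) (timeDerivWithin (Ico 0 T) f t x) (Ico 0 T) t :=
      hfs.hasDerivWithinAt_timeDerivWithin hS (hsub ht) x
    have : timeDerivWithin (Ico 0 T) f t x = f' t x := by simp [hf', hf]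
    rw [← this]
    exact h1.mono hsub
  have hnonneg : ∀ t ∈ Ico t₁ T, ∀ x : E³, 0 ≤ f t x := fun t _ x => sq_nonneg _
  -- S4a: derivative bound and uniform decay on `[0, t₂] ⊇ [t₁, t₂]`
  have hS4a := stub_uniformDecay ν T u p hν hT hsol hLH hdec
  have hbound : ∀ t₂ ∈ Ico t₁ T, ∃ B : ℝ, ∀ t ∈ Icc t₁ t₂, ∀ x : E³, |f' t x| ≤ B := by
    intro t₂ ht₂
    obtain ⟨⟨B, hB⟩, -⟩ := hS4a t₂ ht₂.2
    exact ⟨B, fun t ht x => hB t ⟨ht₁0.1.trans ht.1, ht.2⟩ x⟩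
  have hdecay : ∀ t₂ ∈ Ico t₁ T, ∀ ε : ℝ, 0 < ε → ∃ R : ℝ, ∀ t ∈ Icc t₁ t₂, ∀ x : E³,
      R ≤ ‖x‖ → f t x ≤ ε := by
    intro t₂ ht₂ ε hε
    obtain ⟨-, hR⟩ := hS4a t₂ ht₂.2
    obtain ⟨R, hR⟩ := hR ε hε
    exact ⟨R, fun t ht x hx => hR t ⟨ht₁0.1.trans ht.1, ht.2⟩ x hx⟩
  -- S3 + the hypothesis: the peak inequality with rate `2 g`
  have hg2c : ContinuousOn (fun t => 2 * g t) (Ico t₁ T) := continuousOn_const.mul hgc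
  have hpeak : ∀ t ∈ Ico t₁ T, ∀ x : E³, IsMaxOn (f t) univ x → 0 < f t x →
      f' t x ≤ (2 * g t) * f t x := by
    intro t ht x hmax hpos
    have hne : curl (u t) x ≠ 0 := by
      intro h0
      simp [hf, h0] at hpos
    have h3 := stub_peakGrowth ν T u p hν.le hT hsol t (hsub ht) x hmax
    have h6 := hgα t ht x hmax hne
    have hsq : 0 ≤ ‖curl (u t) x‖ ^ 2 := sq_nonneg _
    calc f' t x ≤ 2 * (‖curl (u t) x‖ ^ 2 * stretchingRate (u t) x) := h3
      _ ≤ 2 * (‖curl (u t) x‖ ^ 2 * g t) := by gcongr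
      _ = (2 * g t) * f t x := by simp [hf]; ring
  -- S4b: the sup-Grönwall bound on `[t₁, T)`
  have hG := stub_supGronwall t₁ T f f' (fun t => 2 * g t) ht₁0.2 hcont hcont' hderiv hnonneg hbound
    hdecay hg2c hpeak
  -- the uniform bound `B⋆ = (sup f(t₁,·)) e^{2I}`
  set M₀ : ℝ := ⨆ y, f t₁ y with hM₀
  have hM₀nn : 0 ≤ M₀ := Real.iSup_nonneg fun y => sq_nonneg _
  have hB : ∀ t ∈ Ico t₁ T, ∀ x : E³, ‖curl (u t) x‖ ^ 2 ≤ M₀ * Real.exp (2 * I) := by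
    intro t ht x
    have h1 := hG t ht x
    have h2 : ∫ s in t₁..t, 2 * g s ≤ 2 * I := by
      rw [intervalIntegral.integral_const_mul]
      linarith [hI t ht]
    calc ‖curl (u t) x‖ ^ 2 = f t x := rfl
      _ ≤ M₀ * Real.exp (∫ s in t₁..t, 2 * g s) := h1
      _ ≤ M₀ * Real.exp (2 * I) := by gcongr
  -- S1: continuation
  exact stub_continuation ν T t₁ (M₀ * Real.exp (2 * I)) u p hν hT ht₁0.2 hsol hLH hdec hB

/-! ### Composition -/

/-- COMPOSITION of the line `Sketch`: the stubs imply the crux `IsobarTomography.BlobRiccatiClosure`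
(by name): the bet S6 delivers a late interval `[t₁, T)` and a majorant `g` of the stretching rate at the
vorticity maxima there, and `peakStretching_continuation` (S1 + S3 + S4a + S4b) continues the solution. -/
theorem BlobRiccatiClosure_of :
    Summit.NavierStokesRegularity.NavierStokesRegularity.Theses.IsobarTomography.BlobRiccatiClosure := by
  intro ν T hν hT u p hsol hLH hdec hblob
  obtain ⟨κ, hκ, Ω, t₀, ht₀, hH⟩ := hblob
  obtain ⟨t₁, ht₁, g, hgc, hI, hgα⟩ :=
    stub_peakStretchingBound stub_pressureLaplacian ν T u p κ Ω t₀ hν hT hsol hLH hdec hκ ht₀ hH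
  exact peakStretching_continuation ν T t₁ u p g hν hT ⟨ht₀.1.trans ht₁.1, ht₁.2⟩ hsol hLH hdec hgc hI hgα

end Summit.NavierStokesRegularity.NavierStokesRegularity.Theorems.IsobarTomographyBlobRiccatiClosure

end
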